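import Summits.AtomisticToContinuum.BoseEinsteinCondensation.Theses.BECInfraredBound
import Summits.AtomisticToContinuum.BoseEinsteinCondensation.Theorems.GroundStateRigidity.Negative.LoadBearingHypotheses
import Literature.MathematicalPhysics.QuantumManyBody.BoseGasFreeProductState
import HarnessLib

/-!
# Negative lemmas for crux `BecShellMass` (stmt-AtomisticToContinuum-0734): load-bearing hypotheses

Refuter (cdisprove) support file for the crux
`Summit.AtomisticToContinuum.BoseEinsteinCondensation.Theses.BECInfraredBound.BecShellMass`
("no boundary accumulation": `δ`-near-minimisers of the Dirichlet energy carry `≤ CεN` particles in the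
shell `Λ_L ∖ (εL, L-εL)³`, `C = C(v)`, `ρ < ρ₀(v, ε)`, `N` large).  No positive statement about the crux is
made here.  Contents (all sorry-free, standard axioms):

* §1 MECHANISM. `exists_shellLoaded` / `eventually_exists_shellLoaded`: in every large box there is a
  Dirichlet trial state (coordinate product of a normalised `C¹` profile supported in `(0, εL)`) with ALL its
  particles in the shell, `N_shell = N`; `not_shellBound_of_groundStateEnergy_eq_top`: hence wherever
  `E₀(N, L) = ⊤` the one-box conclusion of the crux is FALSE (not vacuous) as soon as `Cε ≤ 1/2`.
* §2 `becShellMass_false_without_nearMin` — the crux with the near-minimiser hypothesis deleted is false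
  (free gas `v ≡ 0`): any proof must use `energy Ψ ≤ E₀ + δ`.
* §3 `becShellMass_false_without_finiteRange` — the crux with `IsRepulsiveFiniteRange v` weakened to
  `Measurable v` is false (`v ≡ ⊤`, `E₀ = ⊤` for `N ≥ 2`): any proof must use the finite range, at least to
  get `E₀ < ⊤` eventually.
* §4 `becShellMass_false_at_all_densities` — the crux with `∃ ρ₀, ∀ ρ < ρ₀` replaced by `∀ ρ > 0` is false
  (unit hard spheres at `ρ = 64`: `E₀ = ⊤` for `N ≥ 64`, landed pigeonhole of
  `GroundStateRigidity/Negative/LoadBearingHypotheses`): any proof must use `ρ < ρ₀(v)`.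
* §5 `shellMass_eq_zero_of_nonpos` — for `ε ≤ 0` the shell mass vanishes identically: the hypothesis
  `0 < ε` of the crux is decoration (the equivalence with the `ε`-unsigned form is in the crux work file
  `Cruxes/BecShellMass/Disproof.lean`).

References: LSSY2005 = Lieb–Seiringer–Solovej–Yngvason, *The Mathematics of the Bose Gas and its
Condensation* (2005), §1.2 and Ch. 2 (the variational set-up); the witnesses are folklore.
-/

noncomputable section

namespace Summit.AtomisticToContinuum.BoseEinsteinCondensation.Theorems.BecShellMass.Negative

open Literature.MathematicalPhysics.QuantumManyBody.BoseGas
open Summit.AtomisticToContinuum.BoseEinsteinCondensation.Theorems.GroundStateRigidity.Negative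
open MeasureTheory Filter Set
open scoped ENNReal NNReal Topology

/-! ## 0. The shell-mass functional -/

/-- `N_shell(w) = ∑ᵢ ∫ 1[xᵢ ∉ (w, L-w)³] |Ψ|²`: the expected number of particles outside the open inner
cube `(w, L - w)³` (the crux takes `w = εL`). [folklore] -/
def shellMass (N : ℕ) (L w : ℝ) (ψ : Config N → ℂ) : ℝ≥0∞ :=
  ∑ i : Fin N, ∫⁻ X, {x : EuclideanSpace ℝ (Fin 3) | ∀ j, x j ∈ Set.Ioo w (L - w)}ᶜ.indicator
      (fun _ => (1 : ℝ≥0∞)) (X i) * (‖ψ X‖₊ : ℝ≥0∞) ^ 2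

/-- `N_shell ≤ N` for every normalised state: the crux has content only for `ε < 1/C`. [folklore] -/
theorem shellMass_le {N : ℕ} {L : ℝ} (w : ℝ) (Ψ : TrialState N L) : shellMass N L w Ψ.ψ ≤ N := by
  unfold shellMass
  calc _ ≤ ∑ i : Fin N, ∫⁻ X, (‖Ψ.ψ X‖₊ : ℝ≥0∞) ^ 2 := by
        refine Finset.sum_le_sum fun i _ => lintegral_mono fun X => ?_
        calc _ ≤ 1 * (‖Ψ.ψ X‖₊ : ℝ≥0∞) ^ 2 := by
              gcongr
              exact Set.indicator_apply_le' (fun _ => le_rfl) (fun _ => zero_le_one)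
          _ = _ := one_mul _
    _ = N := by simp [Ψ.norm_eq]

/-! ## 1. Mechanism: shell-loaded product states

A Dirichlet trial state all of whose particles live in the corner cube `(0, w)³ ⊂ Λ_L` has `N_shell(w) = N`.
It is the coordinate product `∏_{(i,k)} g(x_{i,k})` of a normalised `C¹` profile `g` supported in `(0, w)`
(the near-optimal sine profile of `BoseGasSineProfileIntegrals`, available for `w ≥ L₀`). -/

/-- A normalised `C¹` profile supported in `(0, w)` exists for all large `w`. [folklore] -/
theorem exists_profile : ∃ L₀ : ℝ, 0 < L₀ ∧ ∀ w : ℝ, L₀ ≤ w → ∃ g : ℝ → ℝ, ContDiff ℝ 1 g ∧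
    HasCompactSupport g ∧ (∀ t, t ∉ Ioo 0 w → g t = 0) ∧ ∫ t, g t ^ 2 = 1 := by
  obtain ⟨L₀, hL₀, H⟩ := exists_nearOptimal_profile one_pos
  refine ⟨L₀, hL₀, fun w hw => ?_⟩
  obtain ⟨g, hgc, hgs, hgz, -, hg1, -⟩ := H w hw
  exact ⟨g, hgc, hgs, hgz, hg1⟩

/-- **Shell-loaded product state.** From a normalised `C¹` profile supported in `(0, w)`, `w ≤ L`, the
product `Ψ(X) = ∏_{(i,k)} g(x_{i,k})` is a Dirichlet trial state of `N` bosons in `Λ_L` with all its mass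
in `(0,w)^{3N}`, hence `N_shell(w) = N`. [folklore] -/
theorem exists_shellLoaded {L w : ℝ} (hwL : w ≤ L) {g : ℝ → ℝ} (hgc : ContDiff ℝ 1 g)
    (hgs : HasCompactSupport g) (hgz : ∀ t, t ∉ Ioo 0 w → g t = 0) (hg1 : ∫ t, g t ^ 2 = 1)
    (N : ℕ) : ∃ Ψ : TrialState N L, shellMass N L w Ψ.ψ = N := by
  classical
  set F : Config N → ℝ := fun X => ∏ p : Fin N × Fin 3, g (X p.1 p.2) with hF
  have hFc : ContDiff ℝ 1 F := contDiff_prod fun p _ =>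
    hgc.comp ((EuclideanSpace.proj p.2).comp (ContinuousLinearMap.proj (R := ℝ) p.1) :
      Config N →L[ℝ] ℝ).contDiff
  set ψ : Config N → ℂ := fun X => ((F X : ℝ) : ℂ) with hψ
  have hψc : ContDiff ℝ 1 ψ := Complex.ofRealCLM.contDiff.comp hFc
  have hint_g2 : Integrable fun t => g t ^ 2 := by
    have h : Integrable (fun t => g t * g t) :=
      (hgc.continuous.mul hgc.continuous).integrable_of_hasCompactSupport hgs.mul_right
    simpa [pow_two] using h
  have hnorm : ∫⁻ X, ((‖ψ X‖₊ : ℝ≥0∞)) ^ 2 = 1 := by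
    have hpt : ∀ X, ((‖ψ X‖₊ : ℝ≥0∞)) ^ 2 =
        ENNReal.ofReal (∏ p : Fin N × Fin 3, g (X p.1 p.2) ^ 2) := by
      intro X
      rw [ennnorm_sq_eq_ofReal, hψ]
      simp only [Complex.norm_real, Real.norm_eq_abs, sq_abs, hF, ← Finset.prod_pow]
    simp_rw [hpt]
    rw [lintegral_ofReal_prod_coord (fun _ t => g t ^ 2) (fun _ _ => sq_nonneg _) fun _ => hint_g2]
    simp [hg1]
  have hzero : ∀ X : Config N, (∃ i k, X i k ∉ Ioo (0 : ℝ) w) → ψ X = 0 := by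
    rintro X ⟨i, k, hik⟩
    have : F X = 0 := Finset.prod_eq_zero (Finset.mem_univ (i, k)) (hgz _ hik)
    simp [hψ, this]
  let Ψ : TrialState N L :=
    { ψ := ψ
      contDiff := hψc
      eq_zero := fun X hX => by
        apply hzero
        by_contra hall
        push Not at hall
        exact hX fun i k => Ioo_subset_Ioo_right hwL (hall i k)
      symm := fun σ X => by
        simp only [hψ, hF, Function.comp_apply]
        congr 1
        exact Equiv.prod_comp (σ.prodCongr (Equiv.refl (Fin 3))) (fun q : Fin N × Fin 3 => g (X q.1 q.2))
      norm_eq := hnorm }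
  refine ⟨Ψ, ?_⟩
  have hterm : ∀ i : Fin N, (∫⁻ X, {x : EuclideanSpace ℝ (Fin 3) | ∀ j, x j ∈ Set.Ioo w (L - w)}ᶜ.indicator
      (fun _ => (1 : ℝ≥0∞)) (X i) * (‖ψ X‖₊ : ℝ≥0∞) ^ 2) = 1 := by
    intro i
    refine Eq.trans (lintegral_congr fun X => ?_) hnorm
    by_cases hX : ψ X = 0
    · simp [hX]
    · have hin : ∀ i k, X i k ∈ Ioo (0 : ℝ) w := by
        by_contra hall
        push Not at hall
        exact hX (hzero X hall)
      have hnot : X i ∉ {x : EuclideanSpace ℝ (Fin 3) | ∀ j, x j ∈ Set.Ioo w (L - w)} := by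
        intro hmem
        have hmem' : ∀ j, X i j ∈ Set.Ioo w (L - w) := hmem
        exact lt_irrefl _ ((hmem' 0).1.trans (hin i 0).2)
      simp only [Set.indicator_of_mem (Set.mem_compl hnot), one_mul]
  calc shellMass N L w Ψ.ψ = ∑ i : Fin N, (1 : ℝ≥0∞) := Finset.sum_congr rfl fun i _ => hterm i
    _ = N := by simp

/-- Along the thermodynamic sequence `L_N = (N/ρ)^{1/3} → ∞`, shell-loaded states with `N_shell(εL_N) = N`
exist for all large `N` (any `ρ > 0`, `0 < ε ≤ 1`). [folklore] -/
theorem eventually_exists_shellLoaded {ρ ε : ℝ} (hρ : 0 < ρ) (hε : 0 < ε) (hε1 : ε ≤ 1) :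
    ∀ᶠ N : ℕ in atTop, ∃ Ψ : TrialState N (sideLength ρ N),
      shellMass N (sideLength ρ N) (ε * sideLength ρ N) Ψ.ψ = N := by
  obtain ⟨L₀, hL₀, H⟩ := exists_profile
  filter_upwards [(tendsto_sideLength_atTop hρ).eventually_ge_atTop (L₀ / ε)] with N hN
  have hL : 0 ≤ sideLength ρ N := (div_pos hL₀ hε).le.trans hN
  have hw : L₀ ≤ ε * sideLength ρ N := by
    rw [div_le_iff₀ hε] at hN
    linarith
  obtain ⟨g, hgc, hgs, hgz, hg1⟩ := H _ hw
  exact exists_shellLoaded (mul_le_of_le_one_left hL hε1) hgc hgs hgz hg1 N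

/-- Arithmetic of the witness: `Cε ≤ 1/2` and `N ≥ 1` give `ofReal (CεN) < N`. [folklore] -/
theorem ofReal_lt_of_half {N : ℕ} (hN : 0 < N) {C ε : ℝ} (hCε : C * ε ≤ 1 / 2) :
    ENNReal.ofReal (C * ε * N) < (N : ℝ≥0∞) := by
  rw [← ENNReal.ofReal_natCast N]
  have hNr : (0 : ℝ) < N := by exact_mod_cast hN
  exact (ENNReal.ofReal_lt_ofReal_iff hNr).2 (by nlinarith)

/-- The constant-killing shell parameter: for `C > 0`, `ε = min (1/8) (1/(2C))` has `0 < ε < 1/4`,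
`ε ≤ 1` and `Cε ≤ 1/2`. [folklore] -/
theorem exists_eps {C : ℝ} (hC : 0 < C) :
    ∃ ε : ℝ, 0 < ε ∧ ε < 1 / 4 ∧ ε ≤ 1 ∧ C * ε ≤ 1 / 2 := by
  refine ⟨min (1 / 8) (1 / (2 * C)), lt_min (by norm_num) (by positivity),
    (min_le_left _ _).trans_lt (by norm_num), (min_le_left _ _).trans (by norm_num), ?_⟩
  calc C * min (1 / 8) (1 / (2 * C)) ≤ C * (1 / (2 * C)) :=
        mul_le_mul_of_nonneg_left (min_le_right _ _) hC.le
    _ = 1 / 2 := by field_simp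

/-- **`E₀ = ⊤` kills the one-box bound** (it is NOT vacuously true there, it is false there): with
`E₀(N, L) = ⊤` every trial state is a near-minimiser at every slack, in particular a shell-loaded one,
whose `N_shell = N > CεN` once `Cε ≤ 1/2`.  So every proof must show `E₀ < ⊤` eventually (hard cores
fit at `ρ < ρ₀`). [folklore] -/
theorem not_shellBound_of_groundStateEnergy_eq_top {v : ℝ → ℝ≥0∞} {N : ℕ} (hN : 0 < N)
    {L C ε : ℝ} (hCε : C * ε ≤ 1 / 2) (hE : groundStateEnergy v N L = ⊤)
    (hΨ : ∃ Ψ : TrialState N L, shellMass N L (ε * L) Ψ.ψ = N) :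
    ¬ (∃ δ : ℝ≥0∞, 0 < δ ∧ ∀ Ψ : TrialState N L, energy v Ψ ≤ groundStateEnergy v N L + δ →
        shellMass N L (ε * L) Ψ.ψ ≤ ENNReal.ofReal (C * ε * N)) := by
  rintro ⟨δ, -, h⟩
  obtain ⟨Ψ, hΨ⟩ := hΨ
  have hb := h Ψ (by rw [hE, top_add]; exact le_top)
  rw [hΨ] at hb
  exact (not_le.2 (ofReal_lt_of_half hN hCε)) hb

/-! ## 2. LOAD-BEARING: the near-minimiser hypothesis

Dropping `energy v Ψ ≤ E₀ + δ` (a bound for ALL Dirichlet trial states) is false already for the free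
gas `v ≡ 0`: shell-loaded states exist in every large box. -/

/-- **Near-minimality is load-bearing**: the crux with the near-minimiser hypothesis (and its slack
`δ`) deleted is false, witnessed at `v ≡ 0` by the shell-loaded product states
(`ε = min (1/8) (1/(2C))`, any density). [folklore] -/
theorem becShellMass_false_without_nearMin :
    ¬ (∀ v : ℝ → ℝ≥0∞, IsRepulsiveFiniteRange v → ∃ C : ℝ, 0 < C ∧ ∀ ε : ℝ, 0 < ε → ε < 1 / 4 →
      ∃ ρ₀ : ℝ, 0 < ρ₀ ∧ ∀ ρ : ℝ, 0 < ρ → ρ < ρ₀ → ∀ᶠ N : ℕ in Filter.atTop,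
        ∀ Ψ : TrialState N (sideLength ρ N),
          ∑ i : Fin N, ∫⁻ X, {x : EuclideanSpace ℝ (Fin 3) | ∀ j, x j ∈
              Set.Ioo (ε * sideLength ρ N) (sideLength ρ N - ε * sideLength ρ N)}ᶜ.indicator
              (fun _ => (1 : ℝ≥0∞)) (X i) * (‖Ψ.ψ X‖₊ : ℝ≥0∞) ^ 2 ≤ ENNReal.ofReal (C * ε * N)) := by
  intro h
  obtain ⟨C, hC, h⟩ := h (fun _ => 0) ⟨measurable_const, 0, fun _ _ => rfl⟩
  obtain ⟨ε, hε, hε4, hε1, hCε⟩ := exists_eps hC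
  obtain ⟨ρ₀, hρ₀, h⟩ := h ε hε hε4
  have h' := h (ρ₀ / 2) (half_pos hρ₀) (half_lt_self hρ₀)
  obtain ⟨N, hN, ⟨Ψ, hΨ⟩, hb⟩ := ((eventually_gt_atTop 0).and
    ((eventually_exists_shellLoaded (half_pos hρ₀) hε hε1).and h')).exists
  have hb' : shellMass N (sideLength (ρ₀ / 2) N) (ε * sideLength (ρ₀ / 2) N) Ψ.ψ ≤
      ENNReal.ofReal (C * ε * N) := hb Ψ
  rw [hΨ] at hb'
  exact (not_le.2 (ofReal_lt_of_half hN hCε)) hb'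

/-! ## 3. LOAD-BEARING: finite range (through `E₀ < ⊤`)

With `IsRepulsiveFiniteRange v` weakened to `Measurable v`, the constant potential `v ≡ ⊤` is admitted;
for `N ≥ 2` every trial state has infinite energy (`interaction_top_eq_top`), `E₀ = ⊤`, every state is a
near-minimiser, and §1 applies. -/

/-- **Finite range is load-bearing**: the crux with `IsRepulsiveFiniteRange v` weakened to
`Measurable v` is false, witnessed at `v ≡ ⊤` (`E₀ = ⊤` for all `N ≥ 2`, shell-loaded states). [folklore] -/
theorem becShellMass_false_without_finiteRange :
    ¬ (∀ v : ℝ → ℝ≥0∞, Measurable v → ∃ C : ℝ, 0 < C ∧ ∀ ε : ℝ, 0 < ε → ε < 1 / 4 →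
      ∃ ρ₀ : ℝ, 0 < ρ₀ ∧ ∀ ρ : ℝ, 0 < ρ → ρ < ρ₀ → ∀ᶠ N : ℕ in Filter.atTop, ∃ δ : ℝ≥0∞, 0 < δ ∧
        ∀ Ψ : TrialState N (sideLength ρ N),
          energy v Ψ ≤ groundStateEnergy v N (sideLength ρ N) + δ →
          ∑ i : Fin N, ∫⁻ X, {x : EuclideanSpace ℝ (Fin 3) | ∀ j, x j ∈
              Set.Ioo (ε * sideLength ρ N) (sideLength ρ N - ε * sideLength ρ N)}ᶜ.indicator
              (fun _ => (1 : ℝ≥0∞)) (X i) * (‖Ψ.ψ X‖₊ : ℝ≥0∞) ^ 2 ≤ ENNReal.ofReal (C * ε * N)) := by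
  intro h
  obtain ⟨C, hC, h⟩ := h (fun _ => ⊤) measurable_const
  obtain ⟨ε, hε, hε4, hε1, hCε⟩ := exists_eps hC
  obtain ⟨ρ₀, hρ₀, h⟩ := h ε hε hε4
  have h' := h (ρ₀ / 2) (half_pos hρ₀) (half_lt_self hρ₀)
  obtain ⟨N, hN2, hΨ, hb⟩ := ((eventually_ge_atTop 2).and
    ((eventually_exists_shellLoaded (half_pos hρ₀) hε hε1).and h')).exists
  refine not_shellBound_of_groundStateEnergy_eq_top (v := fun _ => ⊤) (by omega) hCε ?_ hΨ hb
  exact groundStateEnergy_eq_top_of_forall fun Ψ =>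
    energy_eq_top_of_interaction_eq_top _ Ψ fun X _ => interaction_top_eq_top hN2 X

/-! ## 4. LOAD-BEARING: low density

With `∃ ρ₀ > 0, ∀ ρ < ρ₀` replaced by `∀ ρ > 0`, the admissible unit hard spheres `⊤·1_{[0,1]}` at density
`ρ = 64` have `E₀(N, (N/64)^{1/3}) = ⊤` for all `N ≥ 64` (pigeonhole, landed for crux `GroundStateRigidity`:
`groundStateEnergy_hardSphere_eq_top`, `ceil_cube_lt`), so again every state is a near-minimiser. -/

/-- **Low density is load-bearing**: the crux with `∃ ρ₀ > 0, ∀ ρ < ρ₀` replaced by `∀ ρ > 0` is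
false, witnessed by unit hard spheres at `ρ = 64` (`E₀ = ⊤` for `N ≥ 64`, shell-loaded states). [folklore] -/
theorem becShellMass_false_at_all_densities :
    ¬ (∀ v : ℝ → ℝ≥0∞, IsRepulsiveFiniteRange v → ∃ C : ℝ, 0 < C ∧ ∀ ε : ℝ, 0 < ε → ε < 1 / 4 →
      ∀ ρ : ℝ, 0 < ρ → ∀ᶠ N : ℕ in Filter.atTop, ∃ δ : ℝ≥0∞, 0 < δ ∧
        ∀ Ψ : TrialState N (sideLength ρ N),
          energy v Ψ ≤ groundStateEnergy v N (sideLength ρ N) + δ →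
          ∑ i : Fin N, ∫⁻ X, {x : EuclideanSpace ℝ (Fin 3) | ∀ j, x j ∈
              Set.Ioo (ε * sideLength ρ N) (sideLength ρ N - ε * sideLength ρ N)}ᶜ.indicator
              (fun _ => (1 : ℝ≥0∞)) (X i) * (‖Ψ.ψ X‖₊ : ℝ≥0∞) ^ 2 ≤ ENNReal.ofReal (C * ε * N)) := by
  intro h
  obtain ⟨C, hC, h⟩ := h _ isRepulsiveFiniteRange_hardSphere
  obtain ⟨ε, hε, hε4, hε1, hCε⟩ := exists_eps hC
  have h' := h ε hε hε4 64 (by norm_num)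
  obtain ⟨N, hN, hΨ, hb⟩ := ((eventually_ge_atTop 64).and
    ((eventually_exists_shellLoaded (by norm_num : (0 : ℝ) < 64) hε hε1).and h')).exists
  exact not_shellBound_of_groundStateEnergy_eq_top (by omega) hCε
    (groundStateEnergy_hardSphere_eq_top (ceil_cube_lt hN)) hΨ hb

/-! ## 5. DECORATION: the hypothesis `0 < ε` is unnecessary

For `ε ≤ 0` the inner cube `(εL, L - εL)³` contains the whole open box, so `N_shell = 0` for every
Dirichlet trial state and the bound holds with any `C`, in `ℝ≥0∞` even for `CεN < 0` (`ofReal`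
truncates); the equivalence of the crux with its `ε`-unsigned form is recorded in the crux work file
(it has the crux as a conclusion, so it does not belong under `Negative/`). -/

/-- For `ε ≤ 0` (and `L ≥ 0`) the shell mass of a Dirichlet trial state vanishes. [folklore] -/
theorem shellMass_eq_zero_of_nonpos {N : ℕ} {L ε : ℝ} (hε : ε ≤ 0) (hL : 0 ≤ L) (Ψ : TrialState N L) :
    shellMass N L (ε * L) Ψ.ψ = 0 := by
  unfold shellMass
  refine Finset.sum_eq_zero fun i _ => ?_
  have hpt : ∀ X, {x : EuclideanSpace ℝ (Fin 3) | ∀ j, x j ∈ Set.Ioo (ε * L) (L - ε * L)}ᶜ.indicator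
      (fun _ => (1 : ℝ≥0∞)) (X i) * (‖Ψ.ψ X‖₊ : ℝ≥0∞) ^ 2 = 0 := by
    intro X
    by_cases hX : Ψ.ψ X = 0
    · simp [hX]
    · have hXb : X ∈ boxN N L := by
        by_contra hc
        exact hX (Ψ.eq_zero X hc)
      have hin : X i ∈ {x : EuclideanSpace ℝ (Fin 3) | ∀ j, x j ∈ Set.Ioo (ε * L) (L - ε * L)} := by
        intro j
        have hj : X i j ∈ Set.Ioo 0 L := hXb i j
        have hεL : ε * L ≤ 0 := by nlinarith
        exact ⟨by linarith [hj.1], by linarith [hj.2]⟩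
      have hnc : X i ∉ ({x : EuclideanSpace ℝ (Fin 3) | ∀ j, x j ∈ Set.Ioo (ε * L) (L - ε * L)})ᶜ :=
        fun hc => hc hin
      rw [Set.indicator_of_notMem hnc, zero_mul]
  simp_rw [hpt]
  exact lintegral_zero

end Summit.AtomisticToContinuum.BoseEinsteinCondensation.Theorems.BecShellMass.Negative

end
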